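import Mathlib.Analysis.Calculus.ParametricIntegral
import Literature.Analysis.FluidPDE.CollisionalTransferTimeDep
import Summits.AtomisticToContinuum.HydrodynamicLimit.Theorems.JParityClosureEvenStressEnskogClusterTransportWeight
import HarnessLib

/-!
# Cluster transport identity, IV: the weighted window integral along a free flight
# (helper file of `stub_clusterTransport`, line `stationary-microscale-hierarchy-entrance-law` of the
# crux `JParityClosure.EvenStressEnskog`, stmt-AtomisticToContinuum-13079)

The `x₀`-integrated observables of the cluster transport identity along a free flight `s ↦ S_s w`:
`I(s) = ∫ W(s, x₀, S_s w) winObs(S_s w, x₀) dx₀`, `A(s) = ∫ Ẇ winObs dx₀`, `B(s) = ∫ W streamObs dx₀`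
(`W = weight σ χ g r`, `Ẇ = weightRate σ χ g r`, parts I–III for the pointwise calculus):

* integrability in the centre of the three integrands (`integrable_weight_mul_winObs`,
  `integrable_weight_mul_streamObs`, `integrable_weightRate_mul_winObs`) and the split
  `∫ (Ẇ winObs + W ε⁻¹ streamObs) = A + ε⁻¹ B` (`integral_rate_split`);
* **differentiation under the integral sign** (`hasDerivAt_integral_weight_winObs_flight`, Mathlib's
  `hasDerivAt_integral_of_dominated_loc_of_lip`): `I` is differentiable at every `t` with
  derivative `∫ (Ẇ winObs + W ε⁻¹ streamObs)(t) dx₀` — the integrand is Lipschitz in `s` UNIFORMLY in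
  the centre (parts II, III) and differentiable at `s = t` for every GOOD centre of `S_t w`, i.e. for
  Haar-a.e. centre (part I, `ae_forall_euclidDist_ne`);
* **continuity of `A`, `B` along the flight** (`continuous_integral_weightRate_winObs_flight`,
  `continuous_integral_weight_streamObs_flight`; dominated convergence, `continuousAt_of_dominated`),
  also with a shifted time origin (primed versions), as the weak balance law
  `IsHardSphereTrajectory.sub_eq_integral_add_finsum_collisionJump_td` requires;
* `intervalIntegrable_of_continuous_flight`: ANY time-dependent observable that is continuous along
  every free flight is interval integrable along a hard-sphere trajectory — a corollary of the weak
  balance law applied to its primitive `t ↦ ∫₀ᵗ Q(u, S_{u-t} w) du`.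

References: H. Spohn, *Large Scale Dynamics of Interacting Particles* (1991), Part I §3.2.
Elementary. [folklore]
-/

noncomputable section

open MeasureTheory Set Filter Function Metric
open scoped BigOperators Topology InnerProductSpace

namespace Summit.AtomisticToContinuum.HydrodynamicLimit.Theorems.EvenStressEnskog

open Literature.Analysis.FluidPDE Literature.Analysis.FunctionSpaces
  Literature.MathematicalPhysics.KineticTheory
  Literature.MathematicalPhysics.KineticTheory.StationaryMicroscale

/-- A continuous real function on the flat `3`-torus is Haar integrable. [folklore] -/
theorem integrable_of_continuous_torus3 : ∀ {f : T3 → ℝ}, Continuous f → Integrable f := by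
  intro f hf
  exact integrableOn_univ.1 (hf.continuousOn.integrableOn_compact isCompact_univ)

/-- **Sup bounds on a unit time window**: nonnegative bounds of `χ`, `∂ₛχ` on `[t-1, t+1] × 𝕋³` and
of `g`, `g′` on `[0, Y]` (compactness). [folklore] -/
theorem exists_flight_bounds {χ : ℝ × T3 → ℝ} {g : ℝ → ℝ} (hχ : Continuous χ)
    (hχ' : Continuous fun p : ℝ × T3 => deriv (fun s => χ (s, p.2)) p.1) (hg : ContDiff ℝ 1 g)
    (t Y : ℝ) :
    ∃ Mχ Mχ' Mg Mg' : ℝ, (0 ≤ Mχ ∧ 0 ≤ Mχ' ∧ 0 ≤ Mg ∧ 0 ≤ Mg') ∧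
      (∀ s ∈ Icc (t - 1) (t + 1), ∀ x : T3, |χ (s, x)| ≤ Mχ) ∧
      (∀ s ∈ Icc (t - 1) (t + 1), ∀ x : T3, |deriv (fun s' => χ (s', x)) s| ≤ Mχ') ∧
      (∀ y ∈ Icc 0 Y, |g y| ≤ Mg) ∧ (∀ y ∈ Icc 0 Y, |deriv g y| ≤ Mg') := by
  have hK : IsCompact (Icc (t - 1) (t + 1) ×ˢ (univ : Set T3)) := isCompact_Icc.prod isCompact_univ
  obtain ⟨Mχ, hMχ⟩ := hK.exists_bound_of_continuousOn hχ.continuousOn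
  obtain ⟨Mχ', hMχ'⟩ := hK.exists_bound_of_continuousOn hχ'.continuousOn
  obtain ⟨Mg, hMg⟩ := (isCompact_Icc (a := (0 : ℝ)) (b := Y)).exists_bound_of_continuousOn
    hg.continuous.continuousOn
  obtain ⟨Mg', hMg'⟩ := (isCompact_Icc (a := (0 : ℝ)) (b := Y)).exists_bound_of_continuousOn
    (hg.continuous_deriv le_rfl).continuousOn
  refine ⟨max Mχ 0, max Mχ' 0, max Mg 0, max Mg' 0,
    ⟨le_max_right _ _, le_max_right _ _, le_max_right _ _, le_max_right _ _⟩,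
    fun s hs x => ?_, fun s hs x => ?_, fun y hy => ?_, fun y hy => ?_⟩
  · exact ((Real.norm_eq_abs _).symm.trans_le (hMχ (s, x) (mk_mem_prod hs (mem_univ x)))).trans
      (le_max_left _ _)
  · exact ((Real.norm_eq_abs _).symm.trans_le (hMχ' (s, x) (mk_mem_prod hs (mem_univ x)))).trans
      (le_max_left _ _)
  · exact ((Real.norm_eq_abs _).symm.trans_le (hMg y hy)).trans (le_max_left _ _)
  · exact ((Real.norm_eq_abs _).symm.trans_le (hMg' y hy)).trans (le_max_left _ _)

section Integral

variable {N m : ℕ} {σ ε ρ r : ℝ} {χ : ℝ × T3 → ℝ} {g : ℝ → ℝ} {P : (Fin m → V3 × V3) → ℝ}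

/-! ## Integrability in the centre -/

/-- `x₀ ↦ W winObs` is integrable (continuous). [folklore] -/
theorem integrable_weight_mul_winObs (σ : ℝ) (hε : 0 < ε) (hρ : ρ < 1 / 2) (hχ : Continuous χ)
    (hg : Continuous g) (hP : ContDiff ℝ 1 P) (hmargin : ∀ q ∈ tsupport P, ∀ a, ε * ‖(q a).1‖ ≤ ρ)
    (r s : ℝ) (z : Config (N + 1) (Fin 3) T3) :
    Integrable fun x₀ : T3 => weight σ χ g r s z x₀ * winObs ε P z x₀ :=
  integrable_of_continuous_torus3
    ((continuous_weight_centre σ hχ hg s z).mul (continuous_winObs_centre hε hρ hP hmargin z))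

/-- `x₀ ↦ W streamObs` is integrable (continuous). [folklore] -/
theorem integrable_weight_mul_streamObs (σ : ℝ) (hε : 0 < ε) (hρ : ρ < 1 / 2) (hχ : Continuous χ)
    (hg : Continuous g) (hP : ContDiff ℝ 1 P) (hmargin : ∀ q ∈ tsupport P, ∀ a, ε * ‖(q a).1‖ ≤ ρ)
    (r s : ℝ) (z : Config (N + 1) (Fin 3) T3) :
    Integrable fun x₀ : T3 => weight σ χ g r s z x₀ * streamObs ε P z x₀ :=
  integrable_of_continuous_torus3
    ((continuous_weight_centre σ hχ hg s z).mul (continuous_streamObs_centre hε hρ hP hmargin z))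

/-- `x₀ ↦ Ẇ winObs` is integrable (bounded and measurable). [folklore] -/
theorem integrable_weightRate_mul_winObs (hσ : 0 ≤ σ) (hε : 0 < ε) (hρ : ρ < 1 / 2) (hr : 0 < r)
    (hχ : Continuous χ) (hχ' : Continuous fun p : ℝ × T3 => deriv (fun s => χ (s, p.2)) p.1)
    (hg : ContDiff ℝ 1 g) (hP : ContDiff ℝ 1 P) (hPc : HasCompactSupport P)
    (hmargin : ∀ q ∈ tsupport P, ∀ a, ε * ‖(q a).1‖ ≤ ρ) (s : ℝ) (z : Config (N + 1) (Fin 3) T3) :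
    Integrable fun x₀ : T3 => weightRate σ χ g r s z x₀ * winObs ε P z x₀ := by
  obtain ⟨MP, hMP0, hMP⟩ := exists_bound_of_hasCompactSupport hP hPc
  obtain ⟨Mχ, Mχ', Mg, Mg', ⟨hMχ0, hMχ'0, hMg0, hMg'0⟩, hχM, hχM', hgM, hgM'⟩ :=
    exists_flight_bounds hχ hχ' hg s (σ ^ 3 * (3 / (Real.pi * r ^ 3)))
  have hV0 : 0 ≤ ∑ k, ‖(z k).2‖ := Finset.sum_nonneg fun k _ => norm_nonneg _
  refine Integrable.of_bound (((measurable_weightRate_centre σ hχ hχ' hg s z).mul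
    (continuous_winObs_centre hε hρ hP hmargin z).measurable).aestronglyMeasurable)
    ((Mχ' * Mg + Mχ * Mg' * (σ ^ 3 * (3 / (Real.pi * r ^ 4) * ∑ k, ‖(z k).2‖))) *
      (Fintype.card (Fin m ↪ Fin (N + 1)) * MP)) (ae_of_all _ fun x₀ => ?_)
  rw [Real.norm_eq_abs, abs_mul]
  have hsS : s ∈ Icc (s - 1) (s + 1) := ⟨by linarith, by linarith⟩
  exact mul_le_mul (abs_weightRate_le hσ hr hχM hχM' hgM hgM' hsS z x₀) (abs_winObs_le hMP ε z x₀)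
    (abs_nonneg _) (by positivity)

/-- **The split of the rate integral**: `∫ (Ẇ winObs + W ε⁻¹ streamObs) = A + ε⁻¹ B`. [folklore] -/
theorem integral_rate_split (hσ : 0 ≤ σ) (hε : 0 < ε) (hρ : ρ < 1 / 2) (hr : 0 < r)
    (hχ : Continuous χ) (hχ' : Continuous fun p : ℝ × T3 => deriv (fun s => χ (s, p.2)) p.1)
    (hg : ContDiff ℝ 1 g) (hP : ContDiff ℝ 1 P) (hPc : HasCompactSupport P)
    (hmargin : ∀ q ∈ tsupport P, ∀ a, ε * ‖(q a).1‖ ≤ ρ) (s : ℝ) (z : Config (N + 1) (Fin 3) T3) :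
    ∫ x₀ : T3, (weightRate σ χ g r s z x₀ * winObs ε P z x₀ +
        weight σ χ g r s z x₀ * (ε⁻¹ * streamObs ε P z x₀)) =
      (∫ x₀ : T3, weightRate σ χ g r s z x₀ * winObs ε P z x₀) +
        ε⁻¹ * ∫ x₀ : T3, weight σ χ g r s z x₀ * streamObs ε P z x₀ := by
  have h2 : Integrable fun x₀ : T3 => weight σ χ g r s z x₀ * (ε⁻¹ * streamObs ε P z x₀) := by
    have h := (integrable_weight_mul_streamObs σ hε hρ hχ hg.continuous hP hmargin r s z).const_mul
      ε⁻¹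
    refine h.congr (ae_of_all _ fun x₀ => ?_)
    beta_reduce
    ring
  rw [integral_add (integrable_weightRate_mul_winObs hσ hε hρ hr hχ hχ' hg hP hPc hmargin s z) h2,
    ← integral_const_mul]
  congr 1
  refine integral_congr_ae (ae_of_all _ fun x₀ => ?_)
  simp only
  ring

/-! ## Differentiation under the integral sign -/

/-- **The weighted window integral is differentiable along a free flight**, at EVERY time `t`, with
derivative `∫ (Ẇ winObs + W ε⁻¹ streamObs)(t, x₀, S_t w) dx₀`: the integrand is Lipschitz in `s`
on `(t-1, t+1)` uniformly in the centre (`abs_weight_flight_sub_le`, `abs_winObs_flight_sub_le`)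
and has this derivative at `s = t` for Haar-a.e. centre (`hasDerivAt_weight_flight`,
`hasDerivAt_winObs_flight`, `ae_forall_euclidDist_ne`). [folklore] -/
theorem hasDerivAt_integral_weight_winObs_flight (hσ : 0 < σ) (hε : 0 < ε) (hρ : ρ < 1 / 2)
    (hr : 0 < r) (hr2 : r < 1 / 2) (hχ : Continuous χ)
    (hχd : ∀ x₀, Differentiable ℝ fun s => χ (s, x₀))
    (hχ' : Continuous fun p : ℝ × T3 => deriv (fun s => χ (s, p.2)) p.1) (hg : ContDiff ℝ 1 g)
    (hP : ContDiff ℝ 1 P) (hPc : HasCompactSupport P)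
    (hmargin : ∀ q ∈ tsupport P, ∀ a, ε * ‖(q a).1‖ ≤ ρ) (w : Config (N + 1) (Fin 3) T3) (t : ℝ) :
    HasDerivAt (fun s : ℝ => ∫ x₀ : T3,
        weight σ χ g r s (freeFlight (Torus.geometry (Fin 3)) s w) x₀ *
          winObs ε P (freeFlight (Torus.geometry (Fin 3)) s w) x₀)
      (∫ x₀ : T3,
        (weightRate σ χ g r t (freeFlight (Torus.geometry (Fin 3)) t w) x₀ *
            winObs ε P (freeFlight (Torus.geometry (Fin 3)) t w) x₀ +
          weight σ χ g r t (freeFlight (Torus.geometry (Fin 3)) t w) x₀ *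
            (ε⁻¹ * streamObs ε P (freeFlight (Torus.geometry (Fin 3)) t w) x₀))) t := by
  obtain ⟨MP, hMP0, hMP⟩ := exists_bound_of_hasCompactSupport hP hPc
  obtain ⟨MP', hMP'0, hMP'⟩ := exists_bound_fderiv_of_hasCompactSupport hP hPc
  obtain ⟨Mχ, Mχ', Mg, Mg', ⟨hMχ0, hMχ'0, hMg0, hMg'0⟩, hχM, hχM', hgM, hgM'⟩ :=
    exists_flight_bounds hχ hχ' hg t (σ ^ 3 * (3 / (Real.pi * r ^ 3)))
  set V : ℝ := ∑ k, ‖(w k).2‖ with hV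
  have hV0 : 0 ≤ V := Finset.sum_nonneg fun k _ => norm_nonneg _
  set cE : ℝ := (Fintype.card (Fin m ↪ Fin (N + 1)) : ℝ) with hcE
  set LW : ℝ := Mχ' * Mg + Mχ * (Mg' * (σ ^ 3 * (3 / (Real.pi * r ^ 4) * V))) with hLW
  set LO : ℝ := cE * (ε⁻¹ * (MP' * V)) with hLO
  set L : ℝ := LW * (cE * MP) + Mχ * Mg * LO with hL
  have hL0 : 0 ≤ L := by positivity
  have hS : Ioo (t - 1) (t + 1) ∈ 𝓝 t := Ioo_mem_nhds (by linarith) (by linarith)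
  refine (hasDerivAt_integral_of_dominated_loc_of_lip (bound := fun _ => L) hS ?_ ?_ ?_ ?_
    (integrable_const L) ?_).2
  · exact Eventually.of_forall fun s =>
      ((continuous_weight_centre σ hχ hg.continuous s _).mul
        (continuous_winObs_centre hε hρ hP hmargin _)).aestronglyMeasurable
  · exact integrable_weight_mul_winObs σ hε hρ hχ hg.continuous hP hmargin r t _
  · exact (((measurable_weightRate_centre σ hχ hχ' hg t _).mul
      (continuous_winObs_centre hε hρ hP hmargin _).measurable).add
      ((continuous_weight_centre σ hχ hg.continuous t _).measurable.mul
        (measurable_const.mul (continuous_streamObs_centre hε hρ hP hmargin _).measurable)))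
      |>.aestronglyMeasurable
  · refine ae_of_all _ fun x₀ => ?_
    rw [Real.nnabs_of_nonneg hL0]
    refine LipschitzOnWith.of_dist_le' fun s hs s' hs' => ?_
    rw [Real.dist_eq, Real.dist_eq]
    have hsI : s ∈ Icc (t - 1) (t + 1) := Ioo_subset_Icc_self hs
    have hs'I : s' ∈ Icc (t - 1) (t + 1) := Ioo_subset_Icc_self hs'
    have hWsub := abs_weight_flight_sub_le (σ := σ) hσ.le hχd hg hr (convex_Icc _ _) hχM hχM' hgM
      hgM' w x₀ hsI hs'I
    have hOsub := abs_winObs_flight_sub_le hε hρ hP hmargin hMP'0 hMP' w x₀ s s'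
    have hW' := abs_weight_le (σ := σ) hσ.le hr hχM hgM hs'I
      (freeFlight (Torus.geometry (Fin 3)) s' w) x₀
    have hO := abs_winObs_le hMP ε (freeFlight (Torus.geometry (Fin 3)) s w) x₀
    set Ws := weight σ χ g r s (freeFlight (Torus.geometry (Fin 3)) s w) x₀
    set Ws' := weight σ χ g r s' (freeFlight (Torus.geometry (Fin 3)) s' w) x₀
    set Os := winObs ε P (freeFlight (Torus.geometry (Fin 3)) s w) x₀
    set Os' := winObs ε P (freeFlight (Torus.geometry (Fin 3)) s' w) x₀
    calc |Ws * Os - Ws' * Os'| = |(Ws - Ws') * Os + Ws' * (Os - Os')| := by ring_nf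
      _ ≤ |Ws - Ws'| * |Os| + |Ws'| * |Os - Os'| := by
          refine (abs_add_le _ _).trans ?_
          rw [abs_mul, abs_mul]
      _ ≤ LW * |s - s'| * (cE * MP) + Mχ * Mg * (LO * |s - s'|) :=
          add_le_add (mul_le_mul hWsub hO (abs_nonneg _) (by positivity))
            (mul_le_mul hW' hOsub (abs_nonneg _) (by positivity))
      _ = L * |s - s'| := by ring
  · filter_upwards [ae_forall_euclidDist_ne hr.ne' (freeFlight (Torus.geometry (Fin 3)) t w)]
      with x₀ hx
    exact (hasDerivAt_weight_flight σ hχd hg hr hr2 w t hx).mul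
      (hasDerivAt_winObs_flight hε hρ hP hmargin w x₀ t)

/-- The same along the flight `s ↦ S_{s - t₀} w` with a shifted time origin. [folklore] -/
theorem hasDerivAt_integral_weight_winObs_flight' (hσ : 0 < σ) (hε : 0 < ε) (hρ : ρ < 1 / 2)
    (hr : 0 < r) (hr2 : r < 1 / 2) (hχ : Continuous χ)
    (hχd : ∀ x₀, Differentiable ℝ fun s => χ (s, x₀))
    (hχ' : Continuous fun p : ℝ × T3 => deriv (fun s => χ (s, p.2)) p.1) (hg : ContDiff ℝ 1 g)
    (hP : ContDiff ℝ 1 P) (hPc : HasCompactSupport P)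
    (hmargin : ∀ q ∈ tsupport P, ∀ a, ε * ‖(q a).1‖ ≤ ρ) (w : Config (N + 1) (Fin 3) T3)
    (t₀ t : ℝ) :
    HasDerivAt (fun s : ℝ => ∫ x₀ : T3,
        weight σ χ g r s (freeFlight (Torus.geometry (Fin 3)) (s - t₀) w) x₀ *
          winObs ε P (freeFlight (Torus.geometry (Fin 3)) (s - t₀) w) x₀)
      (∫ x₀ : T3,
        (weightRate σ χ g r t (freeFlight (Torus.geometry (Fin 3)) (t - t₀) w) x₀ *
            winObs ε P (freeFlight (Torus.geometry (Fin 3)) (t - t₀) w) x₀ +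
          weight σ χ g r t (freeFlight (Torus.geometry (Fin 3)) (t - t₀) w) x₀ *
            (ε⁻¹ * streamObs ε P (freeFlight (Torus.geometry (Fin 3)) (t - t₀) w) x₀))) t := by
  simpa only [sub_eq_add_neg, freeFlight_add] using
    hasDerivAt_integral_weight_winObs_flight hσ hε hρ hr hr2 hχ hχd hχ' hg hP hPc hmargin
      (freeFlight (Torus.geometry (Fin 3)) (-t₀) w) t

/-! ## Continuity of the two rate integrals along a flight -/

/-- **`A(t) = ∫ Ẇ winObs` is continuous along a free flight** (dominated convergence: a uniform
bound near `t`, and continuity at `t` for every good centre of `S_t w`). [folklore] -/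
theorem continuous_integral_weightRate_winObs_flight (hσ : 0 < σ) (hε : 0 < ε) (hρ : ρ < 1 / 2)
    (hr : 0 < r) (hr2 : r < 1 / 2) (hχ : Continuous χ)
    (hχ' : Continuous fun p : ℝ × T3 => deriv (fun s => χ (s, p.2)) p.1) (hg : ContDiff ℝ 1 g)
    (hP : ContDiff ℝ 1 P) (hPc : HasCompactSupport P)
    (hmargin : ∀ q ∈ tsupport P, ∀ a, ε * ‖(q a).1‖ ≤ ρ) (w : Config (N + 1) (Fin 3) T3) :
    Continuous fun t : ℝ => ∫ x₀ : T3,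
      weightRate σ χ g r t (freeFlight (Torus.geometry (Fin 3)) t w) x₀ *
        winObs ε P (freeFlight (Torus.geometry (Fin 3)) t w) x₀ := by
  refine continuous_iff_continuousAt.2 fun t => ?_
  obtain ⟨MP, hMP0, hMP⟩ := exists_bound_of_hasCompactSupport hP hPc
  obtain ⟨Mχ, Mχ', Mg, Mg', ⟨hMχ0, hMχ'0, hMg0, hMg'0⟩, hχM, hχM', hgM, hgM'⟩ :=
    exists_flight_bounds hχ hχ' hg t (σ ^ 3 * (3 / (Real.pi * r ^ 3)))
  set C : ℝ := (Mχ' * Mg + Mχ * Mg' * (σ ^ 3 * (3 / (Real.pi * r ^ 4) * ∑ k, ‖(w k).2‖))) *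
    (Fintype.card (Fin m ↪ Fin (N + 1)) * MP) with hC
  have hS : Ioo (t - 1) (t + 1) ∈ 𝓝 t := Ioo_mem_nhds (by linarith) (by linarith)
  refine continuousAt_of_dominated (bound := fun _ => C) ?_ ?_ (integrable_const C) ?_
  · exact Eventually.of_forall fun s =>
      ((measurable_weightRate_centre σ hχ hχ' hg s _).mul
        (continuous_winObs_centre hε hρ hP hmargin _).measurable).aestronglyMeasurable
  · filter_upwards [hS] with s hs
    refine ae_of_all _ fun x₀ => ?_
    rw [Real.norm_eq_abs, abs_mul]
    have h1 := abs_weightRate_le (σ := σ) hσ.le hr hχM hχM' hgM hgM' (Ioo_subset_Icc_self hs)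
      (freeFlight (Torus.geometry (Fin 3)) s w) x₀
    simp only [freeFlight_apply] at h1
    exact mul_le_mul h1 (abs_winObs_le hMP ε _ x₀) (abs_nonneg _) (by positivity)
  · filter_upwards [ae_forall_euclidDist_ne hr.ne' (freeFlight (Torus.geometry (Fin 3)) t w)]
      with x₀ hx
    exact (continuousAt_weightRate_flight σ hχ hχ' hg hr2 w t hx).mul
      (hasDerivAt_winObs_flight hε hρ hP hmargin w x₀ t).continuousAt

/-- **`B(t) = ∫ W streamObs` is continuous along a free flight** (dominated convergence; here the
integrand is continuous in `t` for every centre). [folklore] -/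
theorem continuous_integral_weight_streamObs_flight (hσ : 0 < σ) (hε : 0 < ε) (hρ : ρ < 1 / 2)
    (hr : 0 < r) (hχ : Continuous χ)
    (hχ' : Continuous fun p : ℝ × T3 => deriv (fun s => χ (s, p.2)) p.1) (hg : ContDiff ℝ 1 g)
    (hP : ContDiff ℝ 1 P) (hPc : HasCompactSupport P)
    (hmargin : ∀ q ∈ tsupport P, ∀ a, ε * ‖(q a).1‖ ≤ ρ) (w : Config (N + 1) (Fin 3) T3) :
    Continuous fun t : ℝ => ∫ x₀ : T3,
      weight σ χ g r t (freeFlight (Torus.geometry (Fin 3)) t w) x₀ *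
        streamObs ε P (freeFlight (Torus.geometry (Fin 3)) t w) x₀ := by
  refine continuous_iff_continuousAt.2 fun t => ?_
  obtain ⟨MP', hMP'0, hMP'⟩ := exists_bound_fderiv_of_hasCompactSupport hP hPc
  obtain ⟨Mχ, Mχ', Mg, Mg', ⟨hMχ0, hMχ'0, hMg0, hMg'0⟩, hχM, hχM', hgM, hgM'⟩ :=
    exists_flight_bounds hχ hχ' hg t (σ ^ 3 * (3 / (Real.pi * r ^ 3)))
  set C : ℝ := Mχ * Mg * (Fintype.card (Fin m ↪ Fin (N + 1)) * (MP' * ∑ k, ‖(w k).2‖)) with hC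
  have hS : Ioo (t - 1) (t + 1) ∈ 𝓝 t := Ioo_mem_nhds (by linarith) (by linarith)
  refine continuousAt_of_dominated (bound := fun _ => C) ?_ ?_ (integrable_const C) ?_
  · exact Eventually.of_forall fun s =>
      ((continuous_weight_centre σ hχ hg.continuous s _).mul
        (continuous_streamObs_centre hε hρ hP hmargin _)).aestronglyMeasurable
  · filter_upwards [hS] with s hs
    refine ae_of_all _ fun x₀ => ?_
    rw [Real.norm_eq_abs, abs_mul]
    have h2 := abs_streamObs_le hMP'0 hMP' ε (freeFlight (Torus.geometry (Fin 3)) s w) x₀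
    simp only [freeFlight_apply] at h2
    have hV0 : 0 ≤ ∑ k, ‖(w k).2‖ := Finset.sum_nonneg fun k _ => norm_nonneg _
    exact mul_le_mul (abs_weight_le (σ := σ) hσ.le hr hχM hgM (Ioo_subset_Icc_self hs) _ x₀) h2
      (abs_nonneg _) (by positivity)
  · exact ae_of_all _ fun x₀ => ((continuous_weight_flight σ hχ hg.continuous w x₀).mul
      (continuous_streamObs_flight hε hρ hP hmargin w x₀)).continuousAt

/-- `A` along the flight `t ↦ S_{t - t₀} w` with a shifted time origin is continuous. [folklore] -/
theorem continuous_integral_weightRate_winObs_flight' (hσ : 0 < σ) (hε : 0 < ε) (hρ : ρ < 1 / 2)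
    (hr : 0 < r) (hr2 : r < 1 / 2) (hχ : Continuous χ)
    (hχ' : Continuous fun p : ℝ × T3 => deriv (fun s => χ (s, p.2)) p.1) (hg : ContDiff ℝ 1 g)
    (hP : ContDiff ℝ 1 P) (hPc : HasCompactSupport P)
    (hmargin : ∀ q ∈ tsupport P, ∀ a, ε * ‖(q a).1‖ ≤ ρ) (w : Config (N + 1) (Fin 3) T3)
    (t₀ : ℝ) :
    Continuous fun t : ℝ => ∫ x₀ : T3,
      weightRate σ χ g r t (freeFlight (Torus.geometry (Fin 3)) (t - t₀) w) x₀ *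
        winObs ε P (freeFlight (Torus.geometry (Fin 3)) (t - t₀) w) x₀ := by
  simpa only [sub_eq_add_neg, freeFlight_add] using
    continuous_integral_weightRate_winObs_flight hσ hε hρ hr hr2 hχ hχ' hg hP hPc hmargin
      (freeFlight (Torus.geometry (Fin 3)) (-t₀) w)

/-- `B` along the flight `t ↦ S_{t - t₀} w` with a shifted time origin is continuous. [folklore] -/
theorem continuous_integral_weight_streamObs_flight' (hσ : 0 < σ) (hε : 0 < ε) (hρ : ρ < 1 / 2)
    (hr : 0 < r) (hχ : Continuous χ)
    (hχ' : Continuous fun p : ℝ × T3 => deriv (fun s => χ (s, p.2)) p.1) (hg : ContDiff ℝ 1 g)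
    (hP : ContDiff ℝ 1 P) (hPc : HasCompactSupport P)
    (hmargin : ∀ q ∈ tsupport P, ∀ a, ε * ‖(q a).1‖ ≤ ρ) (w : Config (N + 1) (Fin 3) T3)
    (t₀ : ℝ) :
    Continuous fun t : ℝ => ∫ x₀ : T3,
      weight σ χ g r t (freeFlight (Torus.geometry (Fin 3)) (t - t₀) w) x₀ *
        streamObs ε P (freeFlight (Torus.geometry (Fin 3)) (t - t₀) w) x₀ := by
  simpa only [sub_eq_add_neg, freeFlight_add] using
    continuous_integral_weight_streamObs_flight hσ hε hρ hr hχ hχ' hg hP hPc hmargin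
      (freeFlight (Torus.geometry (Fin 3)) (-t₀) w)

end Integral

/-! ## Interval integrability along a trajectory of free-flight-continuous observables -/

/-- **Free-flight-continuous observables are interval integrable along a hard-sphere trajectory.**
If `t ↦ Q(t, S_{t-t₀} w)` is continuous for every configuration `w` and time origin `t₀`, then
`s ↦ Q(s, γ s)` is interval integrable on every window: the weak balance law
`IsHardSphereTrajectory.sub_eq_integral_add_finsum_collisionJump_td` for the primitive
`F(t, w) = ∫₀ᵗ Q(u, S_{u-t} w) du`, whose free-streaming derivative is `Q` (FTC-1). [folklore] -/
theorem intervalIntegrable_of_continuous_flight {N : ℕ} {ε' : ℝ} {γ : ℝ → Config (N + 1) (Fin 3) T3}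
    (hγ : IsHardSphereTrajectory (Torus.geometry (Fin 3)) ε' (N + 1) γ)
    {Q : ℝ → Config (N + 1) (Fin 3) T3 → ℝ}
    (hQ : ∀ (w : Config (N + 1) (Fin 3) T3) (t₀ : ℝ),
      Continuous fun t => Q t (freeFlight (Torus.geometry (Fin 3)) (t - t₀) w))
    {a b : ℝ} (hab : a ≤ b) : IntervalIntegrable (fun s => Q s (γ s)) volume a b := by
  have hF : ∀ (w : Config (N + 1) (Fin 3) T3) (t₀ t : ℝ), HasDerivAt
      (fun s => (fun (t' : ℝ) (w' : Config (N + 1) (Fin 3) T3) =>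
        ∫ u in (0 : ℝ)..t', Q u (freeFlight (Torus.geometry (Fin 3)) (u - t') w')) s
          (freeFlight (Torus.geometry (Fin 3)) (s - t₀) w))
      (Q t (freeFlight (Torus.geometry (Fin 3)) (t - t₀) w)) t := by
    intro w t₀ t
    have e : (fun s : ℝ => ∫ u in (0 : ℝ)..s, Q u (freeFlight (Torus.geometry (Fin 3)) (u - s)
        (freeFlight (Torus.geometry (Fin 3)) (s - t₀) w))) =
        fun s => ∫ u in (0 : ℝ)..s, Q u (freeFlight (Torus.geometry (Fin 3)) (u - t₀) w) := by
      funext s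
      simp only [← freeFlight_add, sub_add_sub_cancel]
    show HasDerivAt (fun s : ℝ => ∫ u in (0 : ℝ)..s, Q u (freeFlight (Torus.geometry (Fin 3)) (u - s)
        (freeFlight (Torus.geometry (Fin 3)) (s - t₀) w))) _ t
    rw [e]
    exact ((hQ w t₀).integral_hasStrictDerivAt 0 t).hasDerivAt
  exact (hγ.sub_eq_integral_add_finsum_collisionJump_td
    (F := fun (t' : ℝ) (w' : Config (N + 1) (Fin 3) T3) =>
      ∫ u in (0 : ℝ)..t', Q u (freeFlight (Torus.geometry (Fin 3)) (u - t') w'))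
    (F' := Q) continuous_translate_torus3 hF hQ hab).1

end Summit.AtomisticToContinuum.HydrodynamicLimit.Theorems.EvenStressEnskog

end
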